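import Literature.Geometry.Riemannian.UniformlyNormalNeighbourhoods
import Literature.Geometry.Riemannian.SegmentsAreGeodesics
import Literature.Geometry.Riemannian.ExpMapDifferential
import Literature.Geometry.Lorentzian.GeodesicConfinement
import HarnessLib

/-!
# Short geodesics on a compact Riemannian manifold: the uniform normal radius, the connecting
vector, geodesic segments and geodesic polygons (Lee 2018, Lemma 6.16 / Prop. 6.11; Milnor 1963, §16)

The elementary "short geodesic" toolkit on a COMPACT Riemannian manifold `(M, g)` (smooth metric,
boundaryless model) used by Birkhoff's curve-shortening process and the broken-geodesic
approximation of loop spaces (Milnor 1963, §16), towards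
`PaternainSaloUhlmann2023_contractible_sublevel`. Definitions (all REAL, with bodies):

* `uniformNormalRadius g hn hg = ε(M,g) > 0` — a radius below which, from EVERY point, radial
  geodesics minimise, metric balls are geodesic balls and `exp_q` is injective (a choice of the
  radius of `exists_uniform_normalRadius`, Lee 2018, Lemma 6.16 with Prop. 6.11/Cor. 6.13).
* `geodesicJoin g hn hg x y = J(x, y) ∈ T_xM` — for `d(x, y) < ε(M,g)`, the unique vector with
  `|J|_g < ε(M,g)` and `exp_x J = y`; then `|J|_g = d(x, y)` (`edist_eq_sqrt_geodesicJoin`) and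
  `J` is continuous in `(x, y)` as a map into `TM` (`continuousOn_totalSpaceMk_geodesicJoin`,
  proved by compactness: `(π, exp)` is a closed embedding of the compact set of short minimising
  vectors).
* `geodesicSegment g hn hg x y t = S(x,y)(t) = γ_{J(x,y)}(t)` — the minimising segment from `x`
  (`t = 0`) to `y` (`t = 1`), jointly continuous in `(x, y, t)` (`continuousOn_geodesicSegment`),
  with the exact distance formulas `d(x, S(t)) = t d(x,y)`, `d(S(t), y) = (1-t) d(x,y)`
  (`edist_geodesicSegment_eq`) and the re-rooting identities `J(x, S(t)) = t J(x,y)`,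
  `J(S(t), y) = (1 - t) S'(t)`.
* `velocity_geodesicSegment_one_eq_geodesicJoin` — **tight isosceles configurations have no
  corner**: if `d(p,q) = d(q,r) = λ ∈ (0, ε)` and `d(p,r) = 2λ` then `S(p,q)'(1) = J(q,r)`
  (corner cutting, Lee 2018 p. 168, `exists_edist_riemannianExpMap_lt_two_mul`) — the rigidity
  step of Birkhoff's argument.
* `glueFin q` — concatenation of `N` paths on `[0, N]` (`continuousOn_glueFin`: continuous when
  the paths vary continuously and match at the junctions); `polygonLoop g hn hg x` — the closed
  geodesic polygon through cyclically ordered points `x : Fin N → M`; `birkhoffStep g hn hg x` —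
  Birkhoff's midpoint map; `polygonEnergy g hg x = ∑ d(xᵢ, xᵢ₊₁)²`.

No named facts (D-0026); all statements proved.

## References

* J. M. Lee, *Introduction to Riemannian Manifolds*, 2nd ed. (2018), Prop. 6.11, Cor. 6.12–6.13,
  Lemma 6.16, Lemma 6.18 (a) (proof, p. 168). [LeeRiemannianManifolds2018]
* J. Milnor, *Morse theory*, Annals of Math. Studies 51, Princeton 1963, §16 (pp. 88–92).
  [Milnor1963]
-/

noncomputable section

open Bundle Set Filter Function Metric Manifold
open scoped Manifold ContDiff Topology ENNReal NNReal

namespace Literature.Geometry.Riemannian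

open Literature.Geometry.Lorentzian
open Literature.Geometry.Lorentzian.PseudoRiemannianMetric

variable {E : Type*} [NormedAddCommGroup E] [NormedSpace ℝ E] {H : Type*} [TopologicalSpace H]
  {I : ModelWithCorners ℝ E H} {M : Type*} [TopologicalSpace M] [ChartedSpace H M]
  [IsManifold I ∞ M] {n : ℕ∞ω} [FiniteDimensional ℝ E] [CompleteSpace E] [T2Space M]
  [I.Boundaryless] [CompactSpace M]
  (g : PseudoRiemannianMetric I n E (TangentSpace I : M → Type _)) [g.HasLeviCivita]

omit [T2Space M] [I.Boundaryless] [CompactSpace M] in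
/-- The Levi-Civita connection of a smooth metric is `C¹` (the `k = 1` case of the tree's
`isLocallyContMDiff_leviCivita_holds`, Gallot–Hulin–Lafontaine 2004, Prop. 2.54).
[cite: GallotHulinLafontaine2004, Prop. 2.54] -/
theorem contMDiffCovariantDerivative_leviCivita_one (hn : (∞ : ℕ∞ω) ≤ n) :
    CovariantDerivative.ContMDiffCovariantDerivative g.leviCivita 1 := by
  haveI : Fact (1 ≤ n) := ⟨le_trans (by exact_mod_cast le_top) hn⟩
  have hk : ((1 : ℕ∞) : ℕ∞ω) + 1 ≤ n := le_trans (by exact_mod_cast le_top) hn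
  exact ⟨g.isLocallyContMDiff_leviCivita_holds 1 hk univ isOpen_univ⟩

/-! ### The uniform normal radius -/

/-- **The uniform normal radius `ε(M, g) > 0` of a compact Riemannian manifold** (a choice of the
radius of `exists_uniform_normalRadius`; Lee 2018, Lemma 6.16 / the injectivity radius of a
compact manifold is positive): below it, radial geodesics from every point minimise, metric balls
are geodesic balls and `exp_q` is injective. [cite: LeeRiemannianManifolds2018, Lemma 6.16] -/
def uniformNormalRadius (hn : (∞ : ℕ∞ω) ≤ n) (hg : g.IsRiemannian) : ℝ :=
  haveI := contMDiffCovariantDerivative_leviCivita_one g hn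
  Classical.choose (exists_uniform_normalRadius g hn hg)

variable {g}

section Spec

/-- The defining properties of `ε(M, g)` (positivity and (1)–(3) of `exists_uniform_normalRadius`).
[cite: LeeRiemannianManifolds2018, Lemma 6.16] -/
theorem uniformNormalRadius_spec (hn : (∞ : ℕ∞ω) ≤ n) (hg : g.IsRiemannian) :
    0 < uniformNormalRadius g hn hg ∧ ∀ q : M,
      (∀ v : TangentSpace I q, g.val q v v < uniformNormalRadius g hn hg ^ 2 →
        g.edist hg q (expMap g.leviCivita q v) = ENNReal.ofReal (Real.sqrt (g.val q v v))) ∧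
      (∀ x : M, g.edist hg q x < ENNReal.ofReal (uniformNormalRadius g hn hg) →
        ∃ v : TangentSpace I q, g.val q v v < uniformNormalRadius g hn hg ^ 2 ∧
          expMap g.leviCivita q v = x) ∧
      InjOn (fun v : TangentSpace I q ↦ expMap g.leviCivita q v)
        {v | g.val q v v < uniformNormalRadius g hn hg ^ 2} := by
  haveI := contMDiffCovariantDerivative_leviCivita_one g hn
  obtain ⟨hε, h⟩ := Classical.choose_spec (exists_uniform_normalRadius g hn hg)
  exact ⟨hε, h⟩

/-- `ε(M, g) > 0`. [cite: LeeRiemannianManifolds2018, Lemma 6.16] -/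
theorem uniformNormalRadius_pos (hn : (∞ : ℕ∞ω) ≤ n) (hg : g.IsRiemannian) : 0 < uniformNormalRadius g hn hg :=
  (uniformNormalRadius_spec hn hg).1

/-- **Radial geodesics shorter than `ε(M,g)` minimise**: `d(q, exp_q v) = |v|_g` for
`|v|_g < ε(M,g)` (Lee 2018, Prop. 6.11 / Cor. 6.12, uniformly on a compact manifold).
[cite: LeeRiemannianManifolds2018, Prop. 6.11 and Lemma 6.16] -/
theorem edist_expMap_eq_sqrt (hn : (∞ : ℕ∞ω) ≤ n) (hg : g.IsRiemannian) {q : M} {v : TangentSpace I q}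
    (hv : g.val q v v < uniformNormalRadius g hn hg ^ 2) :
    g.edist hg q (expMap g.leviCivita q v) = ENNReal.ofReal (Real.sqrt (g.val q v v)) :=
  ((uniformNormalRadius_spec hn hg).2 q).1 v hv

/-- **Metric balls of radius `< ε(M,g)` are geodesic balls**: every `x` with `d(q, x) < ε(M,g)` is
`exp_q v` with `|v|_g < ε(M,g)` (Lee 2018, Cor. 6.13, uniformly). [cite: LeeRiemannianManifolds2018, Cor. 6.13 and Lemma 6.16] -/
theorem exists_expMap_eq_of_edist_lt (hn : (∞ : ℕ∞ω) ≤ n) (hg : g.IsRiemannian) {q x : M}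
    (hx : g.edist hg q x < ENNReal.ofReal (uniformNormalRadius g hn hg)) :
    ∃ v : TangentSpace I q, g.val q v v < uniformNormalRadius g hn hg ^ 2 ∧
      expMap g.leviCivita q v = x :=
  ((uniformNormalRadius_spec hn hg).2 q).2.1 x hx

/-- **`exp_q` is injective on the `g`-ball of radius `ε(M,g)`** (Lee 2018, Lemma 6.16).
[cite: LeeRiemannianManifolds2018, Lemma 6.16] -/
theorem injOn_expMap_ball (hn : (∞ : ℕ∞ω) ≤ n) (hg : g.IsRiemannian) (q : M) :
    InjOn (fun v : TangentSpace I q ↦ expMap g.leviCivita q v)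
      {v | g.val q v v < uniformNormalRadius g hn hg ^ 2} :=
  ((uniformNormalRadius_spec hn hg).2 q).2.2

end Spec

/-! ### The connecting vector of two nearby points -/

variable (g) in
/-- **The connecting vector `J(x, y) ∈ T_xM` of two points at distance `< ε(M,g)`**: the unique
`v ∈ T_xM` with `|v|_g < ε(M,g)` and `exp_x v = y` — the initial velocity of the unique
minimising geodesic from `x` to `y` parametrised on `[0, 1]` (Lee 2018, Prop. 6.11; Milnor 1963,
§16: "the unique minimal geodesic joining nearby points depends differentiably on the points");
junk value `0` when `d(x, y) ≥ ε(M,g)`. [cite: Milnor1963, §16 (p. 88–89)] -/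
def geodesicJoin (hn : (∞ : ℕ∞ω) ≤ n) (hg : g.IsRiemannian) (x y : M) : TangentSpace I x :=
  haveI := Classical.dec
  if h : ∃ v : TangentSpace I x, g.val x v v < uniformNormalRadius g hn hg ^ 2 ∧
      expMap g.leviCivita x v = y then h.choose else 0

section Join

/-- Defining property of the connecting vector: for `d(x, y) < ε(M,g)`, `|J(x,y)|_g < ε(M,g)` and
`exp_x J(x,y) = y`. [cite: LeeRiemannianManifolds2018, Lemma 6.16] -/
theorem geodesicJoin_spec (hn : (∞ : ℕ∞ω) ≤ n) (hg : g.IsRiemannian) {x y : M}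
    (hxy : g.edist hg x y < ENNReal.ofReal (uniformNormalRadius g hn hg)) :
    g.val x (geodesicJoin g hn hg x y) (geodesicJoin g hn hg x y) < uniformNormalRadius g hn hg ^ 2 ∧
      expMap g.leviCivita x (geodesicJoin g hn hg x y) = y := by
  have h : ∃ v : TangentSpace I x, g.val x v v < uniformNormalRadius g hn hg ^ 2 ∧
      expMap g.leviCivita x v = y := exists_expMap_eq_of_edist_lt hn hg hxy
  rw [geodesicJoin, dif_pos h]
  exact h.choose_spec

/-- **Uniqueness of the short connecting vector**: any `w ∈ T_xM` with `|w|_g < ε(M,g)` and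
`exp_x w = y` is `J(x, y)`. [cite: LeeRiemannianManifolds2018, Lemma 6.16] -/
theorem geodesicJoin_eq_of_expMap_eq (hn : (∞ : ℕ∞ω) ≤ n) (hg : g.IsRiemannian) {x y : M} {w : TangentSpace I x}
    (hw : g.val x w w < uniformNormalRadius g hn hg ^ 2) (hwy : expMap g.leviCivita x w = y) :
    geodesicJoin g hn hg x y = w := by
  have hε := uniformNormalRadius_pos hn hg
  have hxy : g.edist hg x y < ENNReal.ofReal (uniformNormalRadius g hn hg) := by
    rw [← hwy, edist_expMap_eq_sqrt hn hg hw, ENNReal.ofReal_lt_ofReal_iff hε, Real.sqrt_lt' hε]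
    exact hw
  obtain ⟨h1, h2⟩ := geodesicJoin_spec hn hg hxy
  exact injOn_expMap_ball hn hg x h1 hw (h2.trans hwy.symm)

/-- `d(x, y) = |J(x, y)|_g` for `d(x, y) < ε(M,g)`. [cite: LeeRiemannianManifolds2018, Prop. 6.11] -/
theorem edist_eq_sqrt_geodesicJoin (hn : (∞ : ℕ∞ω) ≤ n) (hg : g.IsRiemannian) {x y : M}
    (hxy : g.edist hg x y < ENNReal.ofReal (uniformNormalRadius g hn hg)) :
    g.edist hg x y = ENNReal.ofReal (Real.sqrt (g.val x (geodesicJoin g hn hg x y)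
      (geodesicJoin g hn hg x y))) := by
  obtain ⟨h1, h2⟩ := geodesicJoin_spec hn hg hxy
  conv_lhs => rw [← h2]
  exact edist_expMap_eq_sqrt hn hg h1

/-- `|J(x, y)|_g = d(x, y)` as real numbers, for `d(x, y) < ε(M,g)`. [cite: LeeRiemannianManifolds2018, Prop. 6.11] -/
theorem sqrt_geodesicJoin_eq_toReal (hn : (∞ : ℕ∞ω) ≤ n) (hg : g.IsRiemannian) {x y : M}
    (hxy : g.edist hg x y < ENNReal.ofReal (uniformNormalRadius g hn hg)) :
    Real.sqrt (g.val x (geodesicJoin g hn hg x y) (geodesicJoin g hn hg x y)) =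
      (g.edist hg x y).toReal := by
  rw [edist_eq_sqrt_geodesicJoin hn hg hxy, ENNReal.toReal_ofReal (Real.sqrt_nonneg _)]

/-- `J(x, x) = 0`. [folklore] -/
theorem geodesicJoin_self (hn : (∞ : ℕ∞ω) ≤ n) (hg : g.IsRiemannian) (x : M) : geodesicJoin g hn hg x x = 0 := by
  haveI := contMDiffCovariantDerivative_leviCivita_one g hn
  refine geodesicJoin_eq_of_expMap_eq hn hg ?_ (expMap_zero (cov := g.leviCivita) x)
  simpa using pow_pos (uniformNormalRadius_pos hn hg) 2

end Join

/-! ### Continuity of the connecting vector -/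

section Continuity

/-- **The connecting vector depends continuously on the pair of points**, on each closed strip
`{d(x, y) ≤ ε'}`, `0 ≤ ε' < ε(M,g)` (Milnor 1963, §16: the minimal geodesic joining nearby points
depends continuously — indeed differentiably — on its endpoints). Proof by compactness: the set
`S = {w ∈ TM : |w|_g ≤ ε', d(π w, exp w) = |w|_g}` is compact, `w ↦ (π w, exp w)` is continuous
and injective on `S` (uniqueness of short connecting vectors), hence a closed embedding of `S`, and
`(x, y) ↦ (x, J(x, y))` is its inverse on the strip. [cite: Milnor1963, §16 (p. 88–89)] -/
theorem continuousOn_totalSpaceMk_geodesicJoin_of_le (hn : (∞ : ℕ∞ω) ≤ n) (hg : g.IsRiemannian) {ε' : ℝ} (hε'0 : 0 ≤ ε')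
    (hε' : ε' < uniformNormalRadius g hn hg) :
    ContinuousOn (fun p : M × M ↦ (⟨p.1, geodesicJoin g hn hg p.1 p.2⟩ : TangentBundle I M))
      {p : M × M | g.edist hg p.1 p.2 ≤ ENNReal.ofReal ε'} := by
  haveI := contMDiffCovariantDerivative_leviCivita_one g hn
  haveI : LocallyCompactSpace M := Manifold.locallyCompact_of_finiteDimensional I
  set ε := uniformNormalRadius g hn hg with hε_def
  have hε : 0 < ε := uniformNormalRadius_pos hn hg
  have hc : IsGeodesicallyComplete g.leviCivita := hopfRinow_compact_geodesicallyComplete hn hg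
  haveI := contMDiffCovariantDerivative_leviCivita_infty g hn
  -- the maps
  set ex : TangentBundle I M → M := fun w ↦ expMap g.leviCivita w.proj w.2 with hex
  have hexc : Continuous ex := by
    have h := contMDiffOn_expMap_totalSpace (cov := g.leviCivita) (k := (⊤ : ℕ∞)) le_top
    have hu : {w : TangentBundle I M | (1 : ℝ) ∈ maximalGeodesicDomain g.leviCivita w.proj w.2} =
        univ := eq_univ_of_forall fun w ↦ by
      show (1 : ℝ) ∈ maximalGeodesicDomain g.leviCivita w.proj w.2
      rw [(maximalGeodesic_of_isGeodesicallyComplete hc w.proj w.2).1]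
      exact mem_univ _
    rw [hu] at h
    exact (contMDiffOn_univ.1 h).continuous
  set Pr : TangentBundle I M → M × M := fun w ↦ (w.proj, ex w) with hPr
  have hPrc : Continuous Pr := (FiberBundle.continuous_proj E (TangentSpace I)).prodMk hexc
  set nrm : TangentBundle I M → ℝ := fun w ↦ g.val w.proj w.2 w.2 with hnrm
  have hnrmc : Continuous nrm := g.continuous_val_tangentBundle
  set S : Set (TangentBundle I M) := {w | nrm w ≤ ε' ^ 2 ∧
    g.edist hg w.proj (ex w) = ENNReal.ofReal (Real.sqrt (nrm w))} with hS
  -- `S` is compact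
  have hScl : IsClosed S := by
    refine (isClosed_le hnrmc continuous_const).inter (isClosed_eq ?_ ?_)
    · exact (PseudoRiemannianMetric.continuous_edist hg).comp
        ((FiberBundle.continuous_proj E (TangentSpace I)).prodMk hexc)
    · exact ENNReal.continuous_ofReal.comp (Real.continuous_sqrt.comp hnrmc)
  have hSc : IsCompact S := by
    obtain ⟨𝒦, h𝒦, h𝒦S⟩ := g.exists_isCompact_tangent_superset (fun x v hv ↦ hg x v hv)
      isCompact_univ (ε' ^ 2)
    exact h𝒦.of_isClosed_subset hScl fun w hw ↦ h𝒦S w (mem_univ _) hw.1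
  -- `Π` is injective on `S`
  have hε'2 : ε' ^ 2 < ε ^ 2 := pow_lt_pow_left₀ hε' hε'0 two_ne_zero
  have hinj : InjOn Pr S := by
    rintro ⟨x₁, v₁⟩ h₁ ⟨x₂, v₂⟩ h₂ h12
    have hx : x₁ = x₂ := congrArg Prod.fst h12
    subst hx
    have hv : expMap g.leviCivita x₁ v₁ = expMap g.leviCivita x₁ v₂ := congrArg Prod.snd h12
    have h : v₁ = v₂ := injOn_expMap_ball hn hg x₁ (lt_of_le_of_lt h₁.1 hε'2) (lt_of_le_of_lt h₂.1 hε'2) hv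
    subst h
    rfl
  -- the join map lands in `S` and `Π ∘ join = id` on the strip
  set A : Set (M × M) := {p : M × M | g.edist hg p.1 p.2 ≤ ENNReal.ofReal ε'} with hA
  set f : M × M → TangentBundle I M :=
    fun p ↦ (⟨p.1, geodesicJoin g hn hg p.1 p.2⟩ : TangentBundle I M) with hf
  have hAlt : ∀ p ∈ A, g.edist hg p.1 p.2 < ENNReal.ofReal ε := fun p hp ↦
    lt_of_le_of_lt hp ((ENNReal.ofReal_lt_ofReal_iff hε).2 hε')
  have hPrf : ∀ p ∈ A, Pr (f p) = p := fun p hp ↦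
    Prod.ext rfl (geodesicJoin_spec hn hg (hAlt p hp)).2
  have hfS : ∀ p ∈ A, f p ∈ S := by
    intro p hp
    have hsq := sqrt_geodesicJoin_eq_toReal hn hg (hAlt p hp)
    refine ⟨?_, ?_⟩
    · show g.val p.1 (geodesicJoin g hn hg p.1 p.2) (geodesicJoin g hn hg p.1 p.2) ≤ ε' ^ 2
      have h1 : (g.edist hg p.1 p.2).toReal ≤ ε' := by
        have h := ENNReal.toReal_mono ENNReal.ofReal_ne_top hp
        rwa [ENNReal.toReal_ofReal hε'0] at h
      have h2 : Real.sqrt (g.val p.1 (geodesicJoin g hn hg p.1 p.2) (geodesicJoin g hn hg p.1 p.2)) ≤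
          ε' := hsq ▸ h1
      have h3 : 0 ≤ g.val p.1 (geodesicJoin g hn hg p.1 p.2) (geodesicJoin g hn hg p.1 p.2) := by
        by_cases h0 : geodesicJoin g hn hg p.1 p.2 = 0
        · rw [h0]; simp
        · exact (hg _ _ h0).le
      calc g.val p.1 (geodesicJoin g hn hg p.1 p.2) (geodesicJoin g hn hg p.1 p.2)
          = Real.sqrt (g.val p.1 (geodesicJoin g hn hg p.1 p.2) (geodesicJoin g hn hg p.1 p.2)) ^ 2 :=
            (Real.sq_sqrt h3).symm
        _ ≤ ε' ^ 2 := pow_le_pow_left₀ (Real.sqrt_nonneg _) h2 2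
    · show g.edist hg p.1 (expMap g.leviCivita p.1 (geodesicJoin g hn hg p.1 p.2)) =
        ENNReal.ofReal (Real.sqrt (g.val p.1 (geodesicJoin g hn hg p.1 p.2) (geodesicJoin g hn hg p.1 p.2)))
      rw [(geodesicJoin_spec hn hg (hAlt p hp)).2]
      exact edist_eq_sqrt_geodesicJoin hn hg (hAlt p hp)
  -- the closed embedding `Π|S` and its inverse
  haveI : CompactSpace S := isCompact_iff_compactSpace.1 hSc
  set PrS : S → M × M := S.restrict Pr with hPrS
  have hPrSc : Continuous PrS := hPrc.comp continuous_subtype_val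
  have hPrSi : Injective PrS := fun a b h ↦ Subtype.ext (hinj a.2 b.2 h)
  have hemb : Topology.IsClosedEmbedding PrS := hPrSc.isClosedEmbedding hPrSi
  set Ψ : S ≃ₜ range PrS := hemb.isEmbedding.toHomeomorph with hΨ
  have hmem : ∀ a : A, (a : M × M) ∈ range PrS := fun a ↦ ⟨⟨f a, hfS a a.2⟩, hPrf a a.2⟩
  rw [continuousOn_iff_continuous_restrict]
  have key : A.restrict f = (fun s : S ↦ (s : TangentBundle I M)) ∘ Ψ.symm ∘
      (fun a : A ↦ (⟨(a : M × M), hmem a⟩ : range PrS)) := by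
    funext a
    have h1 : Ψ ⟨f a, hfS a a.2⟩ = ⟨(a : M × M), hmem a⟩ := by
      apply Subtype.ext
      have h1' : ((Ψ ⟨f a, hfS a a.2⟩ : range PrS) : M × M) = PrS ⟨f a, hfS a a.2⟩ := rfl
      rw [h1']
      exact hPrf a a.2
    simp only [comp_apply, restrict_apply]
    rw [← h1, Homeomorph.symm_apply_apply]
  rw [key]
  exact continuous_subtype_val.comp (Ψ.symm.continuous.comp
    (continuous_subtype_val.subtype_mk _))

/-- **The connecting vector is continuous on the open strip `{d(x, y) < ε(M,g)}`**, as a map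
into `TM`. [cite: Milnor1963, §16 (p. 88–89)] -/
theorem continuousOn_totalSpaceMk_geodesicJoin (hn : (∞ : ℕ∞ω) ≤ n) (hg : g.IsRiemannian) :
    ContinuousOn (fun p : M × M ↦ (⟨p.1, geodesicJoin g hn hg p.1 p.2⟩ : TangentBundle I M))
      {p : M × M | g.edist hg p.1 p.2 < ENNReal.ofReal (uniformNormalRadius g hn hg)} := by
  intro p hp
  have hε := uniformNormalRadius_pos hn hg
  obtain ⟨ε', hε'0, hpε', hε'ε⟩ := ENNReal.lt_iff_exists_real_btwn.1 hp
  have hε' : ε' < uniformNormalRadius g hn hg := (ENNReal.ofReal_lt_ofReal_iff hε).1 hε'ε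
  have h := continuousOn_totalSpaceMk_geodesicJoin_of_le hn hg hε'0 hε'
  have hnhds : {q : M × M | g.edist hg q.1 q.2 ≤ ENNReal.ofReal ε'} ∈ 𝓝 p := by
    have hopen : IsOpen {q : M × M | g.edist hg q.1 q.2 < ENNReal.ofReal ε'} :=
      isOpen_lt (PseudoRiemannianMetric.continuous_edist hg) continuous_const
    exact mem_of_superset (hopen.mem_nhds hpε') fun q (hq : g.edist hg q.1 q.2 < _) ↦
      (le_of_lt hq : g.edist hg q.1 q.2 ≤ ENNReal.ofReal ε')
  exact (h.continuousAt hnhds).continuousWithinAt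

end Continuity

/-! ### The geodesic segment between two nearby points -/

variable (g) in
/-- **The short geodesic segment `S(x, y)(t) = γ_{J(x,y)}(t) = exp_x(t J(x,y))`** from `x`
(`t = 0`) to `y` (`t = 1`), for `d(x, y) < ε(M,g)`: the unique minimising geodesic between nearby
points, parametrised proportionally to arc length on `[0, 1]` (and extended to all `t ∈ ℝ` as the
maximal geodesic). Milnor 1963, §16 (broken geodesics). [cite: Milnor1963, §16 (p. 88–89)] -/
def geodesicSegment (hn : (∞ : ℕ∞ω) ≤ n) (hg : g.IsRiemannian) (x y : M) (t : ℝ) : M :=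
  maximalGeodesic g.leviCivita x (geodesicJoin g hn hg x y) t

section Segment

/-- Unfolding of `geodesicSegment`. [folklore] -/
theorem geodesicSegment_def (hn : (∞ : ℕ∞ω) ≤ n) (hg : g.IsRiemannian) (x y : M) (t : ℝ) :
    geodesicSegment g hn hg x y t = maximalGeodesic g.leviCivita x (geodesicJoin g hn hg x y) t := rfl

/-- Unfolding of `geodesicSegment` as a curve. [folklore] -/
theorem geodesicSegment_eq_maximalGeodesic (hn : (∞ : ℕ∞ω) ≤ n) (hg : g.IsRiemannian) (x y : M) :
    geodesicSegment g hn hg x y = maximalGeodesic g.leviCivita x (geodesicJoin g hn hg x y) := rfl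

/-- `S(x, y)(0) = x`. [folklore] -/
theorem geodesicSegment_zero (hn : (∞ : ℕ∞ω) ≤ n) (hg : g.IsRiemannian) (x y : M) : geodesicSegment g hn hg x y 0 = x := by
  haveI := contMDiffCovariantDerivative_leviCivita_one g hn
  haveI : Fact (1 ≤ n) := ⟨le_trans (by exact_mod_cast le_top) hn⟩
  exact (maximalGeodesic_of_isGeodesicallyComplete
    (hopfRinow_compact_geodesicallyComplete hn hg) x _).2.2.1

/-- `S(x, y)(1) = y` for `d(x, y) < ε(M,g)`. [folklore] -/
theorem geodesicSegment_one (hn : (∞ : ℕ∞ω) ≤ n) (hg : g.IsRiemannian) {x y : M}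
    (hxy : g.edist hg x y < ENNReal.ofReal (uniformNormalRadius g hn hg)) :
    geodesicSegment g hn hg x y 1 = y := by
  haveI := contMDiffCovariantDerivative_leviCivita_one g hn
  haveI : Fact (1 ≤ n) := ⟨le_trans (by exact_mod_cast le_top) hn⟩
  rw [geodesicSegment_def, ← expMap_eq_maximalGeodesic (hopfRinow_compact_geodesicallyComplete hn hg)]
  exact (geodesicJoin_spec hn hg hxy).2

/-- `S(x, y)(t) = exp_x (t J(x, y))`. [cite: LeeRiemannianManifolds2018, Prop. 5.19 (b)] -/
theorem geodesicSegment_eq_expMap (hn : (∞ : ℕ∞ω) ≤ n) (hg : g.IsRiemannian) (x y : M) (t : ℝ) :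
    geodesicSegment g hn hg x y t = expMap g.leviCivita x (t • geodesicJoin g hn hg x y) := by
  haveI := contMDiffCovariantDerivative_leviCivita_one g hn
  haveI : Fact (1 ≤ n) := ⟨le_trans (by exact_mod_cast le_top) hn⟩
  rw [expMap_smul (hopfRinow_compact_geodesicallyComplete hn hg)]
  rfl

/-- `S(x, x)(t) = x`. [folklore] -/
theorem geodesicSegment_self (hn : (∞ : ℕ∞ω) ≤ n) (hg : g.IsRiemannian) (x : M) (t : ℝ) : geodesicSegment g hn hg x x t = x := by
  haveI := contMDiffCovariantDerivative_leviCivita_one g hn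
  haveI : Fact (1 ≤ n) := ⟨le_trans (by exact_mod_cast le_top) hn⟩
  rw [geodesicSegment_eq_expMap, geodesicJoin_self, smul_zero]
  exact expMap_zero (cov := g.leviCivita) x

/-- The geodesic segment is a geodesic defined on `ℝ`. [folklore] -/
theorem isGeodesic_geodesicSegment (hn : (∞ : ℕ∞ω) ≤ n) (hg : g.IsRiemannian) (x y : M) :
    IsGeodesic g.leviCivita (geodesicSegment g hn hg x y) := by
  haveI := contMDiffCovariantDerivative_leviCivita_one g hn
  haveI : Fact (1 ≤ n) := ⟨le_trans (by exact_mod_cast le_top) hn⟩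
  exact (maximalGeodesic_of_isGeodesicallyComplete
    (hopfRinow_compact_geodesicallyComplete hn hg) x _).2.1

/-- The initial velocity of the geodesic segment is the connecting vector. [folklore] -/
theorem velocity_geodesicSegment_zero (hn : (∞ : ℕ∞ω) ≤ n) (hg : g.IsRiemannian) (x y : M) :
    velocity I (geodesicSegment g hn hg x y) 0 = geodesicJoin g hn hg x y := by
  haveI := contMDiffCovariantDerivative_leviCivita_one g hn
  haveI : Fact (1 ≤ n) := ⟨le_trans (by exact_mod_cast le_top) hn⟩
  exact (maximalGeodesic_of_isGeodesicallyComplete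
    (hopfRinow_compact_geodesicallyComplete hn hg) x _).2.2.2

/-- **The geodesic segment depends continuously on its endpoints and the parameter**: the map
`((x, y), t) ↦ S(x, y)(t)` is continuous on `{d(x, y) < ε(M,g)} × ℝ` (continuity of the connecting
vector and of the geodesic flow). [cite: Milnor1963, §16 (p. 88–89)] -/
theorem continuousOn_geodesicSegment (hn : (∞ : ℕ∞ω) ≤ n) (hg : g.IsRiemannian) :
    ContinuousOn (fun p : (M × M) × ℝ ↦ geodesicSegment g hn hg p.1.1 p.1.2 p.2)
      ({p : M × M | g.edist hg p.1 p.2 < ENNReal.ofReal (uniformNormalRadius g hn hg)} ×ˢ univ) := by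
  haveI := contMDiffCovariantDerivative_leviCivita_one g hn
  haveI := contMDiffCovariantDerivative_leviCivita_infty g hn
  haveI : Fact (1 ≤ n) := ⟨le_trans (by exact_mod_cast le_top) hn⟩
  have hc := hopfRinow_compact_geodesicallyComplete hn hg
  have hflow : Continuous fun q : TangentBundle I M × ℝ ↦
      maximalGeodesic g.leviCivita q.1.proj q.1.2 q.2 :=
    ((Bundle.contMDiff_proj (TangentSpace I : M → Type _)).comp
      (contMDiff_tangentLift_maximalGeodesic_complete hc)).continuous
  have hJ := continuousOn_totalSpaceMk_geodesicJoin hn hg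
  have h2 : ContinuousOn (fun p : (M × M) × ℝ ↦
      ((⟨p.1.1, geodesicJoin g hn hg p.1.1 p.1.2⟩ : TangentBundle I M), p.2))
      ({p : M × M | g.edist hg p.1 p.2 < ENNReal.ofReal (uniformNormalRadius g hn hg)} ×ˢ univ) :=
    (hJ.comp continuousOn_fst fun p hp ↦ hp.1).prodMk continuousOn_snd
  exact hflow.comp_continuousOn h2

/-- **Upper bound for distances along the segment**: `d(S(s), S(t)) ≤ (t - s) d(x, y)` for
`s ≤ t` (the segment has constant speed `|J(x,y)|_g = d(x,y)`; `edist_maximalGeodesic_le_length`).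
[cite: LeeRiemannianManifolds2018, Cor. 5.6] -/
theorem edist_geodesicSegment_le (hn : (∞ : ℕ∞ω) ≤ n) (hg : g.IsRiemannian) {x y : M}
    (hxy : g.edist hg x y < ENNReal.ofReal (uniformNormalRadius g hn hg)) {s t : ℝ} (hst : s ≤ t) :
    g.edist hg (geodesicSegment g hn hg x y s) (geodesicSegment g hn hg x y t) ≤
      ENNReal.ofReal (t - s) * g.edist hg x y := by
  haveI := contMDiffCovariantDerivative_leviCivita_one g hn
  haveI : Fact (1 ≤ n) := ⟨le_trans (by exact_mod_cast le_top) hn⟩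
  have hc := hopfRinow_compact_geodesicallyComplete hn hg
  have h := edist_maximalGeodesic_le_length (g := g) hg hc x (geodesicJoin g hn hg x y) hst
  rw [length_maximalGeodesic hg hc, sqrt_geodesicJoin_eq_toReal hn hg hxy,
    ENNReal.ofReal_mul (sub_nonneg.2 hst), ENNReal.ofReal_toReal (ne_top_of_lt hxy)] at h
  exact h

/-- **Distances from the endpoints along the segment are exact**: `d(x, S(t)) = t d(x,y)` and
`d(S(t), y) = (1 - t) d(x,y)` for `t ∈ [0, 1]` (both are `≤` by `edist_geodesicSegment_le`, and
they add up to at least `d(x,y)`). [cite: LeeRiemannianManifolds2018, Prop. 6.11] -/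
theorem edist_geodesicSegment_eq (hn : (∞ : ℕ∞ω) ≤ n) (hg : g.IsRiemannian) {x y : M}
    (hxy : g.edist hg x y < ENNReal.ofReal (uniformNormalRadius g hn hg)) {t : ℝ}
    (ht : t ∈ Icc (0 : ℝ) 1) :
    g.edist hg x (geodesicSegment g hn hg x y t) = ENNReal.ofReal t * g.edist hg x y ∧
      g.edist hg (geodesicSegment g hn hg x y t) y = ENNReal.ofReal (1 - t) * g.edist hg x y := by
  set d := g.edist hg x y with hd
  have hfin : d ≠ ⊤ := ne_top_of_lt hxy
  have h1 : g.edist hg x (geodesicSegment g hn hg x y t) ≤ ENNReal.ofReal t * d := by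
    have h := edist_geodesicSegment_le hn hg hxy ht.1
    rwa [geodesicSegment_zero, sub_zero] at h
  have h2 : g.edist hg (geodesicSegment g hn hg x y t) y ≤ ENNReal.ofReal (1 - t) * d := by
    have h := edist_geodesicSegment_le hn hg hxy ht.2
    rwa [geodesicSegment_one hn hg hxy] at h
  have hsum : ENNReal.ofReal t * d + ENNReal.ofReal (1 - t) * d = d := by
    rw [← add_mul, ← ENNReal.ofReal_add ht.1 (sub_nonneg.2 ht.2), add_sub_cancel, ENNReal.ofReal_one,
      one_mul]
  have htri : d ≤ g.edist hg x (geodesicSegment g hn hg x y t) +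
      g.edist hg (geodesicSegment g hn hg x y t) y := edist_triangle hg _ _ _
  have hA : ENNReal.ofReal t * d ≠ ⊤ := ENNReal.mul_ne_top ENNReal.ofReal_ne_top hfin
  have hB : ENNReal.ofReal (1 - t) * d ≠ ⊤ := ENNReal.mul_ne_top ENNReal.ofReal_ne_top hfin
  constructor
  · refine le_antisymm h1 ?_
    by_contra hlt
    push Not at hlt
    have : g.edist hg x (geodesicSegment g hn hg x y t) + g.edist hg (geodesicSegment g hn hg x y t) y <
        ENNReal.ofReal t * d + ENNReal.ofReal (1 - t) * d :=
      ENNReal.add_lt_add_of_lt_of_le (ne_top_of_le_ne_top hB h2) hlt h2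
    rw [hsum] at this
    exact absurd (lt_of_le_of_lt htri this) (lt_irrefl _)
  · refine le_antisymm h2 ?_
    by_contra hlt
    push Not at hlt
    have : g.edist hg x (geodesicSegment g hn hg x y t) + g.edist hg (geodesicSegment g hn hg x y t) y <
        ENNReal.ofReal t * d + ENNReal.ofReal (1 - t) * d :=
      ENNReal.add_lt_add_of_le_of_lt (ne_top_of_le_ne_top hA h1) h1 hlt
    rw [hsum] at this
    exact absurd (lt_of_le_of_lt htri this) (lt_irrefl _)

/-- Points of the segment are within `ε(M,g)` of its endpoints. [folklore] -/
theorem edist_geodesicSegment_lt (hn : (∞ : ℕ∞ω) ≤ n) (hg : g.IsRiemannian) {x y : M}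
    (hxy : g.edist hg x y < ENNReal.ofReal (uniformNormalRadius g hn hg)) {t : ℝ}
    (ht : t ∈ Icc (0 : ℝ) 1) :
    g.edist hg x (geodesicSegment g hn hg x y t) < ENNReal.ofReal (uniformNormalRadius g hn hg) ∧
      g.edist hg (geodesicSegment g hn hg x y t) y < ENNReal.ofReal (uniformNormalRadius g hn hg) := by
  obtain ⟨h1, h2⟩ := edist_geodesicSegment_eq hn hg hxy ht
  have hle1 : ENNReal.ofReal t * g.edist hg x y ≤ g.edist hg x y := by
    calc ENNReal.ofReal t * g.edist hg x y ≤ 1 * g.edist hg x y := by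
          gcongr
          rw [← ENNReal.ofReal_one]
          exact ENNReal.ofReal_le_ofReal ht.2
      _ = g.edist hg x y := one_mul _
  have hle2 : ENNReal.ofReal (1 - t) * g.edist hg x y ≤ g.edist hg x y := by
    calc ENNReal.ofReal (1 - t) * g.edist hg x y ≤ 1 * g.edist hg x y := by
          gcongr
          rw [← ENNReal.ofReal_one]
          exact ENNReal.ofReal_le_ofReal (by linarith [ht.1])
      _ = g.edist hg x y := one_mul _
  exact ⟨h1 ▸ lt_of_le_of_lt hle1 hxy, h2 ▸ lt_of_le_of_lt hle2 hxy⟩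

/-- **The connecting vector from `x` to a point of the segment**: `J(x, S(x,y)(t)) = t J(x, y)` for
`t ∈ [0, 1]` (uniqueness of short connecting vectors: `exp_x(t J) = S(t)` and `|t J|_g < ε`).
[cite: Milnor1963, §16 (p. 88–89)] -/
theorem geodesicJoin_left_geodesicSegment (hn : (∞ : ℕ∞ω) ≤ n) (hg : g.IsRiemannian) {x y : M}
    (hxy : g.edist hg x y < ENNReal.ofReal (uniformNormalRadius g hn hg)) {t : ℝ}
    (ht : t ∈ Icc (0 : ℝ) 1) :
    geodesicJoin g hn hg x (geodesicSegment g hn hg x y t) = t • geodesicJoin g hn hg x y := by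
  refine geodesicJoin_eq_of_expMap_eq hn hg ?_ (geodesicSegment_eq_expMap hn hg x y t).symm
  have h1 := (geodesicJoin_spec hn hg hxy).1
  have h0 : 0 ≤ g.val x (geodesicJoin g hn hg x y) (geodesicJoin g hn hg x y) := by
    by_cases h : geodesicJoin g hn hg x y = 0
    · rw [h]; simp
    · exact (hg _ _ h).le
  simp only [map_smul, FunLike.coe_smul, Pi.smul_apply, smul_eq_mul]
  have ht2 : t * t ≤ 1 := by nlinarith [ht.1, ht.2]
  nlinarith

/-- **The connecting vector from a point of the segment to its endpoint**:
`J(S(x,y)(t), y) = (1 - t) S(x,y)'(t)` for `t ∈ [0, 1]` (the rest of the segment, reparametrised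
on `[0, 1]`, is the short geodesic from `S(t)` to `y`: flow property and uniqueness).
[cite: Milnor1963, §16 (p. 88–89)] -/
theorem geodesicJoin_geodesicSegment_right (hn : (∞ : ℕ∞ω) ≤ n) (hg : g.IsRiemannian) {x y : M}
    (hxy : g.edist hg x y < ENNReal.ofReal (uniformNormalRadius g hn hg)) {t : ℝ}
    (ht : t ∈ Icc (0 : ℝ) 1) :
    geodesicJoin g hn hg (geodesicSegment g hn hg x y t) y =
      (1 - t) • velocity I (geodesicSegment g hn hg x y) t := by
  haveI := contMDiffCovariantDerivative_leviCivita_one g hn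
  haveI : Fact (1 ≤ n) := ⟨le_trans (by exact_mod_cast le_top) hn⟩
  have hc := hopfRinow_compact_geodesicallyComplete hn hg
  refine geodesicJoin_eq_of_expMap_eq hn hg ?_ ?_
  · -- `|(1 - t) S'(t)|² = (1 - t)² |J|² < ε²`
    have hspeed : g.val (geodesicSegment g hn hg x y t) (velocity I (geodesicSegment g hn hg x y) t)
        (velocity I (geodesicSegment g hn hg x y) t) =
        g.val x (geodesicJoin g hn hg x y) (geodesicJoin g hn hg x y) :=
      val_velocity_maximalGeodesic hc x (geodesicJoin g hn hg x y) t
    have h1 := (geodesicJoin_spec hn hg hxy).1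
    have h0 : 0 ≤ g.val x (geodesicJoin g hn hg x y) (geodesicJoin g hn hg x y) := by
      by_cases h : geodesicJoin g hn hg x y = 0
      · rw [h]; simp
      · exact (hg _ _ h).le
    simp only [map_smul, FunLike.coe_smul, Pi.smul_apply, smul_eq_mul]
    rw [hspeed]
    have ht2 : (1 - t) * (1 - t) ≤ 1 := by nlinarith [ht.1, ht.2]
    nlinarith
  · have key : expMap g.leviCivita (geodesicSegment g hn hg x y t)
        ((1 - t) • velocity I (geodesicSegment g hn hg x y) t) =
        maximalGeodesic g.leviCivita (geodesicSegment g hn hg x y t)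
          (velocity I (geodesicSegment g hn hg x y) t) (1 - t) := expMap_smul hc _ _ _
    rw [key, geodesicSegment_eq_maximalGeodesic, maximalGeodesic_velocity_apply hc, sub_add_cancel,
      ← geodesicSegment_eq_maximalGeodesic, geodesicSegment_one hn hg hxy]

end Segment

/-! ### Tight isosceles configurations have no corner (Birkhoff) -/

section Tight

/-- **A broken geodesic realising the distance between its endpoints has no corner** (Lee 2018,
proof of Lemma 6.18 (a), p. 168, "it has no corners", via corner cutting; Milnor 1963, §16;
this is the step "equality in the triangle inequality forces smoothness" of Birkhoff's
curve-shortening argument). Let `d(p, q) = d(q, r) = λ ∈ (0, ε(M,g))` and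
`d(p, r) = d(p, q) + d(q, r)`. Then the short segment from `p` to `q` arrives at `q` with velocity
equal to the connecting vector `J(q, r)`: the broken geodesic `p → q → r` is smooth at `q`. Proof:
if the arriving unit direction `a` differed from the departing one `b`, corner cutting
(`exists_edist_riemannianExpMap_lt_two_mul`) would give `d(γ₁(1 - s/λ), γ₂(s/λ)) < 2s` for small
`s`, whereas `d(p, r) ≤ d(p, γ₁(1 - s/λ)) + d(γ₁(1 - s/λ), γ₂(s/λ)) + d(γ₂(s/λ), r)` with the outer
terms equal to `λ - s` forces `≥ 2s`. [cite: LeeRiemannianManifolds2018, Lemma 6.18 (a) (proof, p. 168)] -/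
theorem velocity_geodesicSegment_one_eq_geodesicJoin (hn : (∞ : ℕ∞ω) ≤ n) (hg : g.IsRiemannian) {p q r : M}
    (hpq : g.edist hg p q < ENNReal.ofReal (uniformNormalRadius g hn hg))
    (hqr : g.edist hg q r < ENNReal.ofReal (uniformNormalRadius g hn hg))
    (hpos : 0 < g.edist hg p q) (heq : g.edist hg p q = g.edist hg q r)
    (htight : g.edist hg p r = g.edist hg p q + g.edist hg q r) :
    velocity I (geodesicSegment g hn hg p q) 1 = geodesicJoin g hn hg q r := by
  haveI := contMDiffCovariantDerivative_leviCivita_one g hn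
  haveI : Fact (1 ≤ n) := ⟨le_trans (by exact_mod_cast le_top) hn⟩
  have hc := hopfRinow_compact_geodesicallyComplete hn hg
  set u := geodesicJoin g hn hg p q with hu_def
  set w := geodesicJoin g hn hg q r with hw_def
  set γ₁ := geodesicSegment g hn hg p q with hγ₁
  set γ₂ := geodesicSegment g hn hg q r with hγ₂
  -- the common length `λ`
  set lam : ℝ := (g.edist hg p q).toReal with hlam_def
  have hfin : g.edist hg p q ≠ ⊤ := ne_top_of_lt hpq
  have hlam : 0 < lam := ENNReal.toReal_pos hpos.ne' hfin
  have hdpq : g.edist hg p q = ENNReal.ofReal lam := (ENNReal.ofReal_toReal hfin).symm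
  have hdqr : g.edist hg q r = ENNReal.ofReal lam := heq ▸ hdpq
  have hnn : ∀ (x : M) (v : TangentSpace I x), 0 ≤ g.val x v v := fun x v ↦ by
    by_cases h : v = 0
    · rw [h]; simp
    · exact (hg x v h).le
  have hu2 : g.val p u u = lam ^ 2 := by
    have h := sqrt_geodesicJoin_eq_toReal hn hg hpq
    rw [← Real.sq_sqrt (hnn p u), h]
  have hw2 : g.val q w w = lam ^ 2 := by
    have h := sqrt_geodesicJoin_eq_toReal hn hg hqr
    rw [← heq] at h
    rw [← Real.sq_sqrt (hnn q w), h]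
  have hγ₁1 : γ₁ 1 = q := geodesicSegment_one hn hg hpq
  -- the arriving velocity
  set v₁ : E := velocity I γ₁ 1 with hv₁_def
  have hv₁ : g.val (γ₁ 1) (show TangentSpace I (γ₁ 1) from v₁) (show TangentSpace I (γ₁ 1) from v₁) =
      lam ^ 2 := (val_velocity_maximalGeodesic hc p u 1).trans hu2
  by_contra hne
  -- unit vectors at `γ₁ 1 = q`
  set a : E := lam⁻¹ • v₁ with ha_def
  set b : E := lam⁻¹ • (show E from w) with hb_def
  have hab : a ≠ b := fun h ↦ hne (smul_right_injective E (inv_ne_zero hlam.ne') h)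
  have ha : g.val (γ₁ 1) (show TangentSpace I (γ₁ 1) from a) (show TangentSpace I (γ₁ 1) from a) = 1 := by
    show g.val (γ₁ 1) (lam⁻¹ • (show TangentSpace I (γ₁ 1) from v₁))
      (lam⁻¹ • (show TangentSpace I (γ₁ 1) from v₁)) = 1
    simp only [map_smul, FunLike.coe_smul, Pi.smul_apply, smul_eq_mul]
    rw [hv₁]
    field_simp
  have hb : g.val (γ₁ 1) (show TangentSpace I (γ₁ 1) from b) (show TangentSpace I (γ₁ 1) from b) = 1 := by
    rw [hγ₁1]
    show g.val q (lam⁻¹ • w) (lam⁻¹ • w) = 1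
    simp only [map_smul, FunLike.coe_smul, Pi.smul_apply, smul_eq_mul]
    rw [hw2]
    field_simp
  obtain ⟨s₀, hs₀, hcut⟩ := exists_edist_riemannianExpMap_lt_two_mul hg hc (γ₁ 1) ha hb hab
  set s : ℝ := min (s₀ / 2) lam with hs_def
  have hs0 : 0 < s := lt_min (by positivity) hlam
  have hss₀ : s < s₀ := lt_of_le_of_lt (min_le_left _ _) (by linarith)
  have hslam : s ≤ lam := min_le_right _ _
  have hlt := hcut s hs0 hss₀
  -- identify the two points with points of the segments
  have hP : riemannianExpMap g (γ₁ 1) (show TangentSpace I (γ₁ 1) from (-s) • a) = γ₁ (1 - s / lam) := by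
    have key : expMap g.leviCivita (γ₁ 1) ((-s * lam⁻¹) • (show TangentSpace I (γ₁ 1) from v₁)) =
        maximalGeodesic g.leviCivita (γ₁ 1) (show TangentSpace I (γ₁ 1) from v₁) (-s * lam⁻¹) :=
      expMap_smul hc _ _ _
    have key2 : maximalGeodesic g.leviCivita (γ₁ 1) (show TangentSpace I (γ₁ 1) from v₁) (-s * lam⁻¹) =
        γ₁ (-s * lam⁻¹ + 1) :=
      maximalGeodesic_velocity_apply hc p u 1 (-s * lam⁻¹)
    have key3 : ((-s) • a : E) = (-s * lam⁻¹) • v₁ := by rw [ha_def, smul_smul]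
    calc riemannianExpMap g (γ₁ 1) (show TangentSpace I (γ₁ 1) from (-s) • a)
        = expMap g.leviCivita (γ₁ 1) ((-s * lam⁻¹) • (show TangentSpace I (γ₁ 1) from v₁)) := by
          rw [key3]; rfl
      _ = γ₁ (1 - s / lam) := by
          rw [key, key2]; congr 1; rw [div_eq_mul_inv]; ring
  have hQ : riemannianExpMap g (γ₁ 1) (show TangentSpace I (γ₁ 1) from s • b) = γ₂ (s / lam) := by
    rw [hγ₁1]
    have key : expMap g.leviCivita q ((s * lam⁻¹) • w) = maximalGeodesic g.leviCivita q w (s * lam⁻¹) :=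
      expMap_smul hc _ _ _
    have key3 : ((s • b : E)) = (s * lam⁻¹) • (show E from w) := by rw [hb_def, smul_smul]
    calc riemannianExpMap g q (show TangentSpace I q from s • b)
        = expMap g.leviCivita q ((s * lam⁻¹) • w) := by rw [key3]; rfl
      _ = γ₂ (s / lam) := by rw [key, hγ₂, geodesicSegment_def, div_eq_mul_inv]
  rw [hP, hQ] at hlt
  -- the outer distances are `λ - s`
  have h1s : 1 - s / lam ∈ Icc (0 : ℝ) 1 :=
    ⟨by rw [sub_nonneg, div_le_one hlam]; exact hslam,
     by have : 0 ≤ s / lam := by positivity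
        linarith⟩
  have h2s : s / lam ∈ Icc (0 : ℝ) 1 := ⟨by positivity, by rw [div_le_one hlam]; exact hslam⟩
  have hAB : ENNReal.ofReal (1 - s / lam) * ENNReal.ofReal lam = ENNReal.ofReal (lam - s) := by
    rw [← ENNReal.ofReal_mul h1s.1]
    congr 1
    field_simp
  have hA : g.edist hg p (γ₁ (1 - s / lam)) = ENNReal.ofReal (lam - s) := by
    rw [(edist_geodesicSegment_eq hn hg hpq h1s).1, hdpq, hAB]
  have hB : g.edist hg (γ₂ (s / lam)) r = ENNReal.ofReal (lam - s) := by
    rw [(edist_geodesicSegment_eq hn hg hqr h2s).2, hdqr, show (1 - s / lam) = 1 - s / lam from rfl, hAB]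
  -- triangle inequality versus tightness
  have htri : g.edist hg p r ≤ g.edist hg p (γ₁ (1 - s / lam)) +
      g.edist hg (γ₁ (1 - s / lam)) (γ₂ (s / lam)) + g.edist hg (γ₂ (s / lam)) r :=
    (edist_triangle hg p (γ₂ (s / lam)) r).trans
      (add_le_add (edist_triangle hg p (γ₁ (1 - s / lam)) (γ₂ (s / lam))) le_rfl)
  rw [htight, hdpq, hdqr, hA, hB] at htri
  have hstrict : ENNReal.ofReal (lam - s) + g.edist hg (γ₁ (1 - s / lam)) (γ₂ (s / lam)) +
      ENNReal.ofReal (lam - s) <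
      ENNReal.ofReal (lam - s) + ENNReal.ofReal (2 * s) + ENNReal.ofReal (lam - s) := by
    refine ENNReal.add_lt_add_right ENNReal.ofReal_ne_top ?_
    exact ENNReal.add_lt_add_left ENNReal.ofReal_ne_top hlt
  have hsum : ENNReal.ofReal (lam - s) + ENNReal.ofReal (2 * s) + ENNReal.ofReal (lam - s) =
      ENNReal.ofReal lam + ENNReal.ofReal lam := by
    rw [← ENNReal.ofReal_add (by linarith) (by linarith), ← ENNReal.ofReal_add (by linarith) (by linarith),
      ← ENNReal.ofReal_add hlam.le hlam.le]
    congr 1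
    ring
  rw [hsum] at hstrict
  exact absurd (lt_of_le_of_lt htri hstrict) (lt_irrefl _)

end Tight

/-! ### Concatenation of finitely many paths -/

section Glue

variable {Y : Type*}

/-- The index `min ⌊t⌋ (N - 1)` of the unit interval `[i, i + 1]` of `[0, N]` containing `t`
(the last one for `t = N`). [folklore] -/
def pieceIndex (N : ℕ) [NeZero N] (t : ℝ) : Fin N :=
  ⟨min ⌊t⌋₊ (N - 1), lt_of_le_of_lt (min_le_right _ _) (Nat.sub_lt (NeZero.pos N) one_pos)⟩

/-- **Concatenation of `N` paths**: the map `[0, N] → Y` which on `[i, i + 1]` is the `i`-th path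
`q i` reparametrised from `[0, 1]` (the usual concatenation of paths, `N` at a time; Milnor 1963,
§16, broken geodesics `ω | [t_{i-1}, t_i]`). [cite: Milnor1963, §16 (p. 88)] -/
def glueFin {N : ℕ} [NeZero N] (q : Fin N → ℝ → Y) (t : ℝ) : Y :=
  q (pieceIndex N t) (t - (pieceIndex N t : ℕ))

variable {N : ℕ} [NeZero N]

/-- For `t ∈ [i, i + 1)`, `i < N`, the piece index is `i`. [folklore] -/
theorem pieceIndex_of_mem {i : Fin N} {t : ℝ} (ht : t ∈ Ico (i : ℝ) (i + 1)) :
    pieceIndex N t = i := by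
  have h0 : (0 : ℝ) ≤ t := le_trans (Nat.cast_nonneg _) ht.1
  have hfl : ⌊t⌋₊ = (i : ℕ) := by
    rw [Nat.floor_eq_iff h0]
    exact ⟨ht.1, ht.2⟩
  apply Fin.ext
  simp only [pieceIndex, hfl]
  exact min_eq_left (by have := i.2; omega)

/-- The piece index of the endpoint `t = N` is `N - 1`. [folklore] -/
theorem pieceIndex_natCast (N : ℕ) [NeZero N] : (pieceIndex N (N : ℝ) : ℕ) = N - 1 := by
  simp only [pieceIndex, Nat.floor_natCast]
  exact min_eq_right (Nat.sub_le _ _)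

/-- For `t ∈ [0, N]` the local parameter `t - pieceIndex N t` lies in `[0, 1]`. [folklore] -/
theorem sub_pieceIndex_mem_Icc {t : ℝ} (ht : t ∈ Icc (0 : ℝ) N) :
    t - (pieceIndex N t : ℕ) ∈ Icc (0 : ℝ) 1 := by
  have hfl : (⌊t⌋₊ : ℝ) ≤ t := Nat.floor_le ht.1
  have hlt : t < ⌊t⌋₊ + 1 := Nat.lt_floor_add_one t
  by_cases h : ⌊t⌋₊ ≤ N - 1
  · have hi : (pieceIndex N t : ℕ) = ⌊t⌋₊ := min_eq_left h
    rw [hi]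
    constructor <;> linarith
  · push Not at h
    have hi : (pieceIndex N t : ℕ) = N - 1 := min_eq_right h.le
    rw [hi, Nat.cast_pred (NeZero.pos N)]
    have hN : (N : ℝ) ≤ ⌊t⌋₊ := by
      have : N ≤ ⌊t⌋₊ := by omega
      exact_mod_cast this
    constructor <;> linarith [ht.2]

/-- The defining formula of the concatenation: `glueFin q t = q i (t - i)` with `i = pieceIndex N t`.
[folklore] -/
theorem glueFin_eq (q : Fin N → ℝ → Y) (t : ℝ) :
    glueFin q t = q (pieceIndex N t) (t - (pieceIndex N t : ℕ)) := rfl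

/-- On `[i, i + 1)` the concatenation is the `i`-th path. [folklore] -/
theorem glueFin_apply_of_mem (q : Fin N → ℝ → Y) {i : Fin N} {t : ℝ}
    (ht : t ∈ Ico (i : ℝ) (i + 1)) : glueFin q t = q i (t - i) := by
  simp only [glueFin, pieceIndex_of_mem ht]

/-- `glueFin q (i + s) = q i s` for `s ∈ [0, 1)`. [folklore] -/
theorem glueFin_natCast_add (q : Fin N → ℝ → Y) (i : Fin N) {s : ℝ} (hs : s ∈ Ico (0 : ℝ) 1) :
    glueFin q ((i : ℕ) + s) = q i s := by
  rw [glueFin_apply_of_mem q (i := i) ⟨by linarith [hs.1], by linarith [hs.2]⟩]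
  congr 1
  ring

/-- At an integer `i < N` the concatenation is the start of the `i`-th path. [folklore] -/
theorem glueFin_natCast (q : Fin N → ℝ → Y) (i : Fin N) : glueFin q (i : ℕ) = q i 0 := by
  have h := glueFin_natCast_add q i (s := 0) ⟨le_rfl, one_pos⟩
  rwa [add_zero] at h

/-- At `t = N` the concatenation is the end of the last path. [folklore] -/
theorem glueFin_last (q : Fin N → ℝ → Y) :
    glueFin q (N : ℝ) = q ⟨N - 1, Nat.sub_lt (NeZero.pos N) one_pos⟩ 1 := by
  have h1 : pieceIndex N (N : ℝ) = ⟨N - 1, Nat.sub_lt (NeZero.pos N) one_pos⟩ :=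
    Fin.ext (pieceIndex_natCast N)
  simp only [glueFin, h1]
  congr 1
  rw [Nat.cast_pred (NeZero.pos N)]
  ring

/-- **The concatenation of continuously varying paths with matching endpoints is continuous**
(jointly in the parameter and the time): if each `(x, s) ↦ Q x i s` is continuous on
`X × [0, 1]` and `Q x i 1 = Q x (i+1) 0`, then `(x, t) ↦ glueFin (Q x) t` is continuous on
`X × [0, N]`. [folklore] -/
theorem continuousOn_glueFin {X : Type*} [TopologicalSpace X] [TopologicalSpace Y]
    {Q : X → Fin N → ℝ → Y}
    (hQ : ∀ i, ContinuousOn (fun p : X × ℝ ↦ Q p.1 i p.2) (univ ×ˢ Icc 0 1))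
    (hmatch : ∀ (x : X) (i j : Fin N), (i : ℕ) + 1 = j → Q x i 1 = Q x j 0) :
    ContinuousOn (fun p : X × ℝ ↦ glueFin (Q p.1) p.2) (univ ×ˢ Icc 0 (N : ℝ)) := by
  set G : X × ℝ → Y := fun p ↦ glueFin (Q p.1) p.2 with hG
  -- on each closed piece `[i, i+1]` the glued map is the `i`-th path
  have hpiece : ∀ i : Fin N, ContinuousOn G (univ ×ˢ Icc (i : ℝ) (i + 1)) := by
    intro i
    have hcont : ContinuousOn (fun p : X × ℝ ↦ Q p.1 i (p.2 - i)) (univ ×ˢ Icc (i : ℝ) (i + 1)) := by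
      have h1 : ContinuousOn (fun p : X × ℝ ↦ (p.1, p.2 - (i : ℝ))) (univ ×ˢ Icc (i : ℝ) (i + 1)) :=
        (continuous_fst.prodMk (continuous_snd.sub continuous_const)).continuousOn
      refine (hQ i).comp h1 ?_
      rintro ⟨x, t⟩ ⟨-, ht⟩
      exact ⟨mem_univ _, by constructor <;> linarith [ht.1, ht.2]⟩
    refine hcont.congr ?_
    rintro ⟨x, t⟩ ⟨-, ht⟩
    dsimp only at ht
    show glueFin (Q x) t = Q x i (t - i)
    rcases lt_or_eq_of_le ht.2 with hlt | heq
    · exact glueFin_apply_of_mem (Q x) ⟨ht.1, hlt⟩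
    · -- the right endpoint `t = i + 1`
      rw [heq, add_sub_cancel_left]
      by_cases hlast : (i : ℕ) + 1 < N
      · set j : Fin N := ⟨(i : ℕ) + 1, hlast⟩ with hj
        have hj' : ((i : ℝ) + 1) = ((j : ℕ) : ℝ) := by simp [hj]
        rw [hj', glueFin_natCast (Q x) j]
        exact (hmatch x i j rfl).symm
      · have hiN : (i : ℕ) + 1 = N := by have := i.2; omega
        have hcast : ((i : ℝ) + 1) = (N : ℝ) := by exact_mod_cast hiN
        rw [hcast, glueFin_last (Q x)]
        congr 1
        exact Fin.ext (by simp; omega)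
  -- induction on the number of pieces
  have hstep : ∀ k : ℕ, k ≤ N → ContinuousOn G (univ ×ˢ Icc 0 (k : ℝ)) := by
    intro k
    induction k with
    | zero =>
      intro _
      have h0 : (univ ×ˢ Icc (0 : ℝ) ((0 : ℕ) : ℝ) : Set (X × ℝ)) ⊆
          univ ×ˢ Icc (((0 : Fin N) : ℕ) : ℝ) (((0 : Fin N) : ℕ) + 1) := by
        rintro ⟨x, t⟩ ⟨-, ht⟩
        refine ⟨mem_univ _, ?_⟩
        simp only [Fin.val_zero, Nat.cast_zero, zero_add] at ht ⊢
        exact ⟨ht.1, by linarith [ht.2]⟩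
      exact (hpiece 0).mono h0
    | succ k ih =>
      intro hk
      have hk' : k < N := hk
      set i : Fin N := ⟨k, hk'⟩ with hi
      have hunion : (univ ×ˢ Icc (0 : ℝ) ((k + 1 : ℕ) : ℝ) : Set (X × ℝ)) =
          univ ×ˢ Icc (0 : ℝ) (k : ℝ) ∪ univ ×ˢ Icc ((i : ℕ) : ℝ) ((i : ℕ) + 1) := by
        rw [← prod_union]
        congr 1
        simp only [hi, Nat.cast_add, Nat.cast_one]
        exact (Icc_union_Icc_eq_Icc (Nat.cast_nonneg k) (by linarith)).symm
      rw [hunion]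
      exact (ih hk'.le).union_of_isClosed (hpiece i) (isClosed_univ.prod isClosed_Icc)
        (isClosed_univ.prod isClosed_Icc)
  exact hstep N le_rfl

end Glue

/-- In `Fin N`, the successor of the last element `N - 1` is `0`. [folklore] -/
theorem Fin.mk_sub_one_add_one (N : ℕ) [NeZero N] :
    (⟨N - 1, Nat.sub_lt (NeZero.pos N) one_pos⟩ + 1 : Fin N) = 0 := by
  apply Fin.ext
  rw [Fin.val_add, Fin.val_zero]
  rcases Nat.lt_or_ge N 2 with hN | hN
  · have hN1 : N = 1 := by have := NeZero.pos N; omega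
    subst hN1
    simp
  · have h1 : ((1 : Fin N) : ℕ) = 1 := by
      rw [Fin.val_one']
      exact Nat.mod_eq_of_lt hN
    rw [h1, Nat.sub_add_cancel (by omega), Nat.mod_self]

/-! ### Geodesic polygons: the closed broken geodesic through `N` cyclically ordered points -/

section Polygon

variable {N : ℕ} [NeZero N]

variable (g) in
/-- **The closed geodesic polygon (broken geodesic) through the cyclically ordered points
`x 0, x 1, …, x (N-1), x 0`**, parametrised on `[0, N]`: on `[i, i + 1]` it is the short geodesic
segment from `x i` to `x (i + 1)` (indices mod `N`). Milnor 1963, §16 (the space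
`Ω(t₀, …, t_k)` of broken geodesics as a finite-dimensional approximation of the loop space);
Birkhoff's curve-shortening polygons. Meaningful when consecutive points are at distance
`< ε(M,g)`. [cite: Milnor1963, §16 (p. 88–89)] -/
def polygonLoop (hn : (∞ : ℕ∞ω) ≤ n) (hg : g.IsRiemannian) (x : Fin N → M) (t : ℝ) : M :=
  glueFin (fun i s ↦ geodesicSegment g hn hg (x i) (x (i + 1)) s) t

variable (g) in
/-- **Birkhoff's midpoint map**: replace each vertex `x i` by the midpoint of the short geodesic
segment from `x i` to `x (i + 1)` (G. D. Birkhoff's curve-shortening process, as in Milnor 1963,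
§16 and Lusternik–Fet; one step). [cite: Milnor1963, §16 (p. 88–89)] -/
def birkhoffStep (hn : (∞ : ℕ∞ω) ≤ n) (hg : g.IsRiemannian) (x : Fin N → M) : Fin N → M :=
  fun i ↦ geodesicSegment g hn hg (x i) (x (i + 1)) (1 / 2)

variable (g) in
/-- **The energy `∑ᵢ d(x i, x (i+1))²` of a geodesic polygon** (Milnor 1963, §16: the energy of
the broken geodesic, up to the factor `N`). [cite: Milnor1963, §16 (p. 88–89)] -/
def polygonEnergy (hg : g.IsRiemannian) (x : Fin N → M) : ℝ :=
  ∑ i, (g.edist hg (x i) (x (i + 1))).toReal ^ 2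

/-- The polygon passes through its vertices: `polygonLoop x i = x i`. [folklore] -/
theorem polygonLoop_natCast (hn : (∞ : ℕ∞ω) ≤ n) (hg : g.IsRiemannian) (x : Fin N → M) (i : Fin N) :
    polygonLoop g hn hg x (i : ℕ) = x i := by
  rw [polygonLoop, glueFin_natCast]
  exact geodesicSegment_zero hn hg _ _

/-- The polygon closes up: `polygonLoop x N = x 0 = polygonLoop x 0`, provided the last side is
short. [folklore] -/
theorem polygonLoop_last (hn : (∞ : ℕ∞ω) ≤ n) (hg : g.IsRiemannian) (x : Fin N → M)
    (hx : g.edist hg (x ⟨N - 1, Nat.sub_lt (NeZero.pos N) one_pos⟩)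
      (x (⟨N - 1, Nat.sub_lt (NeZero.pos N) one_pos⟩ + 1)) <
      ENNReal.ofReal (uniformNormalRadius g hn hg)) :
    polygonLoop g hn hg x (N : ℝ) = x 0 := by
  rw [polygonLoop, glueFin_last]
  rw [geodesicSegment_one hn hg hx, Fin.mk_sub_one_add_one]

/-- `polygonLoop x 0 = x 0`. [folklore] -/
theorem polygonLoop_zero (hn : (∞ : ℕ∞ω) ≤ n) (hg : g.IsRiemannian) (x : Fin N → M) : polygonLoop g hn hg x 0 = x 0 := by
  have h := polygonLoop_natCast hn hg x 0
  simpa using h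

/-- On `[i, i + 1)` the polygon is the `i`-th segment. [folklore] -/
theorem polygonLoop_apply_of_mem (hn : (∞ : ℕ∞ω) ≤ n) (hg : g.IsRiemannian) (x : Fin N → M) {i : Fin N} {t : ℝ}
    (ht : t ∈ Ico (i : ℝ) (i + 1)) :
    polygonLoop g hn hg x t = geodesicSegment g hn hg (x i) (x (i + 1)) (t - i) :=
  glueFin_apply_of_mem _ ht

/-- **The polygon depends continuously on its vertices and the time**, on the set of polygons
with short sides. [cite: Milnor1963, §16 (p. 88–89)] -/
theorem continuousOn_polygonLoop (hn : (∞ : ℕ∞ω) ≤ n) (hg : g.IsRiemannian) :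
    ContinuousOn (fun p : (Fin N → M) × ℝ ↦ polygonLoop g hn hg p.1 p.2)
      ({x : Fin N → M | ∀ i, g.edist hg (x i) (x (i + 1)) <
        ENNReal.ofReal (uniformNormalRadius g hn hg)} ×ˢ Icc 0 (N : ℝ)) := by
  set S : Set (Fin N → M) := {x | ∀ i, g.edist hg (x i) (x (i + 1)) <
    ENNReal.ofReal (uniformNormalRadius g hn hg)} with hS
  -- work on the subtype `S`
  have key : ContinuousOn (fun p : S × ℝ ↦ polygonLoop g hn hg (p.1 : Fin N → M) p.2) (univ ×ˢ Icc 0 (N : ℝ)) := by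
    refine continuousOn_glueFin (Q := fun (x : S) i s ↦ geodesicSegment g hn hg (x.1 i) (x.1 (i + 1)) s)
      (fun i ↦ ?_) (fun x i j hij ↦ ?_)
    · have h := continuousOn_geodesicSegment hn hg
      have h1 : Continuous fun p : S × ℝ ↦ (((p.1 : Fin N → M) i, (p.1 : Fin N → M) (i + 1)), p.2) :=
        ((((continuous_apply i).comp continuous_subtype_val).prodMk
          ((continuous_apply (i + 1)).comp continuous_subtype_val)).comp continuous_fst).prodMk
          continuous_snd
      refine h.comp h1.continuousOn ?_
      rintro ⟨x, s⟩ -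
      exact ⟨x.2 i, mem_univ _⟩
    · have hlt : (i : ℕ) + 1 < N := by rw [hij]; exact j.2
      have hj : i + 1 = j :=
        Fin.ext (by rw [Fin.val_add, Fin.val_one', Nat.add_mod_mod, Nat.mod_eq_of_lt hlt, hij])
      rw [geodesicSegment_one hn hg (x.2 i), geodesicSegment_zero, hj]
  rintro ⟨x, t⟩ hp
  have hp1 : x ∈ S := hp.1
  have h2 := key ⟨⟨x, hp1⟩, t⟩ ⟨mem_univ _, hp.2⟩
  rw [ContinuousWithinAt, nhdsWithin_prod_eq, nhdsWithin_univ] at h2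
  show Tendsto _ (𝓝[S ×ˢ Icc 0 (N : ℝ)] (x, t)) _
  rw [nhdsWithin_prod_eq,
    ← (map_nhds_subtype_val ⟨x, hp1⟩ : map Subtype.val (𝓝 (⟨x, hp1⟩ : S)) = 𝓝[S] x),
    Filter.prod_map_left, tendsto_map'_iff]
  exact h2

end Polygon

end Literature.Geometry.Riemannian
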